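import Literature.NumberTheory.Automorphic.ShimuraCurveIdealsPrincipal
import Literature.NumberTheory.Automorphic.ShimuraCurveVolumeSplitCase
import Literature.NumberTheory.Automorphic.QuaternionNormOneLatticePoints
import Literature.NumberTheory.Automorphic.QuaternionAlgebraIntegralModel
import Literature.NumberTheory.Automorphic.QuaternionInvolutionToolkit
import Literature.NumberTheory.Automorphic.QuaternionOrderIntegral
import Literature.NumberTheory.Automorphic.QuaternionLocalSplit
import Literature.NumberTheory.Automorphic.BrandtModuleSplitLocal
import Literature.NumberTheory.Automorphic.BrandtDataRingEquiv
import Literature.NumberTheory.Automorphic.ShimuraCurve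
import HarnessLib

/-!
# Strong approximation in residue form: the norm-one units of an order of an indefinite
# quaternion algebra over `ℚ` surject onto the norm-one residues modulo a prime

Topic `NumberTheory/Automorphic`; theorems only (no definition, no named fact, no instance, no
`sorry`). Let `B/ℚ` be a quaternion algebra admitting a `ℚ`-algebra map `ι : B → M₂(ℝ)` (so `B`
is INDEFINITE: `isSplitAtInfinite_of_algHom_real`), `O ⊆ B` a `ℤ`-order (`Brandt.IsOrder`) and
`q` a prime.

* `exists_reducedNorm_eq_one_sub_eq_smul_of_prime` — **residue form of Eichler–Kneser strong
  approximation at a prime**: if `x₀ ∈ O` has `nrd x₀ ≡ 1 (mod q)` then there is `u ∈ O` with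
  `nrd u = 1` and `u ≡ x₀ (mod q O)`; at `q = 2` under the extra hypothesis that `trd(x₀ ȳ)` is odd
  for some `y ∈ O` (necessary in general: for `O = ℤ + 2M₂(ℤ)` and `x₀ = diag(3, 1)` every
  `u ≡ x₀ (mod 2O)` has `nrd u ≡ 3 (mod 4)`; the hypothesis holds as soon as `O ⊗ 𝔽₂ ≅ M₂(𝔽₂)`).
  PROOF (Vignéras III §4 Thm. 4.3, lattice form of the tree
  `QuaternionAlgebra.exists_mem_mul_star_eq_one`, transported to an integral model `B ≃ ℍ[ℚ,a,b]`
  exactly as in `ShimuraCurveData.exists_eq_units_smul_of_pos` ∕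
  `CartanLevelCurveData.exists_normOne_mul_mem`): first improve `x₀` inside `x₀ + 2O` to
  `nrd ≡ 1 (mod 16)` when `q = 2` (three `2`-adic Newton steps `x ↦ x + 2^e m y`, using
  `nrd(x + z) = nrd x + nrd z + trd(x z̄)` and `trd(y ȳ) = 2 nrd y`); the lattice
  `Λ = ℤ x₀ + q O` is full and has local points of norm `1 + 8d`, `|d|_p < 1`, at every `p`
  (`x₀` at `p = q`, `1` elsewhere), so it contains `u₀ = c x₀ + q y` of norm `1`; reducing
  `nrd u₀ = 1` modulo `q` gives `c² ≡ 1`, i.e. `c ≡ ±1 (mod q)`, and `u = ±u₀` works.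
* `exists_reducedNorm_eq_one_map_eq_of_det_eq_one` — **the same through a residue map**: for a
  subring `S = O` and a ring map `red : S → M₂(𝔽_q)` which is onto, has kernel `q O` and satisfies
  `det ∘ red = nrd (mod q)` (the fields of a reduction datum `O ↠ O ⊗ 𝔽_q ≅ M₂(𝔽_q)` at a prime
  where `O` is maximal and `B` is split), every `g ∈ M₂(𝔽_q)` with `det g = 1` is `red u` for some
  `u ∈ O` of reduced norm `1`: **`O¹ ↠ SL₂(𝔽_q)`** (Vignéras III §5, application of Thm. 4.3 with
  `S = {∞}` satisfying the Eichler condition; Shimura 1971 Lemma 1.38 is the case `B = M₂(ℚ)`).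
  The parity witness at `q = 2` is read off `red` (`trd(x ȳ) ≡ det(g + Y) - det g - det Y`).
* `exists_mem_normOneUnits_coe_eq` — bookkeeping: an element `u ∈ O` of reduced norm `1` gives an
  element `γ ∈ ι(O¹) = normOneUnits ι hO ≤ GL₂(ℝ)` with matrix `ι u`.

Filed by the BSD cell `bsd-stepL` (seat `defn-ty1` g42) as the literature engine of the print input
(M0) `StrongApproxAtCartanPlace` («`redHom : ι(O₀'¹) → GL₂(𝔽_q)` is onto `SL₂(𝔽_q)`») of crux
stmt-BirchSwinnertonDyer-24801, line `Lines/lattice.lean` v6 ∕ `Lines/charext.lean`; nothing here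
mentions curves, and nothing arithmetic is asserted about any curve. presearch: [corpus:
book:vignerasnd-arithmetique-des-algebres-de-quaternions p0070–p0071] Thm. 4.3 and its proof,
§5 applications 5.8–5.9; [corpus: paper:arxiv-1405.6674 p3–4] Thm. 2.1 «consequence of strong
approximation»; tree: lattice form `exists_mem_mul_star_eq_one`, no residue form
(`lean search 'SL.*ZMod.*surj'`, `'normOneUnits.*red'` — none).

## References

* M.-F. Vignéras, *Arithmétique des algèbres de quaternions*, LNM 800 (1980), Ch. III §4
  Thm. 4.3 (approximation forte) and §5; Ch. I §4 Lemme 4.1. [cite: VignerasLNM800, Ch. III §4 Thm. 4.3 and §5]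
* G. Shimura, *Introduction to the arithmetic theory of automorphic functions* (1971),
  Lemma 1.38 (`SL₂(ℤ) → SL₂(ℤ/Nℤ)` is onto). [cite: ShimuraIATAF1971, Lemma 1.38]
* J. Voight, *Quaternion Algebras*, GTM 288 (2021), Thm. 28.5.3 and Cor. 28.5.4.
  [cite: Voight2021, Thm. 28.5.3 and Cor. 28.5.4]
-/

noncomputable section

open scoped NumberField Quaternion

namespace Literature.NumberTheory.Automorphic

variable {B : Type} [Ring B] [Algebra ℚ B] [IsQuaternionAlgebra ℚ B]

/-! ### 1. Norm-one elements of an order as elements of `ι(O¹)` -/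

/-- **An element of reduced norm `1` of `O` gives an element of `Γ = ι(O¹)`** with matrix `ι u`
(its inverse is `ι ū`, `ū ∈ O`; `det ι u = nrd u = 1`). [cite: VignerasLNM800, Ch. IV §1 (groupes de quaternions) and Ch. I §4 Lemme 4.12] -/
theorem exists_mem_normOneUnits_coe_eq (ι : B →ₐ[ℚ] Matrix (Fin 2) (Fin 2) ℝ) {O : Submodule ℤ B}
    (hO : Brandt.IsOrder B O) {u : B} (hu : u ∈ O) (hnu : reducedNorm ℚ B u = 1) :
    ∃ γ ∈ normOneUnits ι hO, ((γ : GL (Fin 2) ℝ) : Matrix (Fin 2) (Fin 2) ℝ) = ι u := by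
  set ub : B := standardInvolution ℚ B u with hub
  have hubO : ub ∈ O := hO.standardInvolution_mem hu
  have hubu : ub * u = 1 := by
    rw [hub, IsQuaternionAlgebra.standardInvolution_mul (K := ℚ), hnu, map_one]
  have hdet1 : (ι u).det = 1 := by
    rw [AlgHom.det_eq_reducedNorm ι, hnu, map_one]
  set γ : GL (Fin 2) ℝ := Matrix.GeneralLinearGroup.mkOfDetNeZero (ι u)
    (by rw [hdet1]; exact one_ne_zero) with hγ
  have hγval : (γ : Matrix (Fin 2) (Fin 2) ℝ) = ι u := rfl
  have hγinv : ((γ⁻¹ : GL (Fin 2) ℝ) : Matrix (Fin 2) (Fin 2) ℝ) = ι ub := by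
    rw [Matrix.coe_units_inv, hγval]
    exact Matrix.inv_eq_left_inv (by rw [← map_mul, hubu, map_one])
  refine ⟨γ, ⟨⟨u, hu, hγval.symm⟩, ⟨ub, hubO, hγinv.symm⟩, ?_⟩, hγval⟩
  ext
  rw [Matrix.GeneralLinearGroup.val_det_apply, hγval, hdet1, Units.val_one]

/-! ### 2. `2`-adic Newton steps inside `x + 2O` -/

/-- One `2`-adic step: if `nrd x = 1 + 2Em` and `trd(x ȳ)` is odd (`x, y ∈ O`), then
`x' = x + 2Em·y ∈ x + 2O` has `nrd x' = 1 + 4Em'` and `trd(x' ȳ)` is still odd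
(`nrd(x + z) = nrd x + nrd z + trd(x z̄)`, `trd(y ȳ) = 2 nrd y`). [cite: VignerasLNM800, Ch. I §1 Lemme 1.1 and Ch. II §1 Lemme 1.10] -/
private theorem twoAdicStep {O : Submodule ℤ B} (hO : Brandt.IsOrder B O) {x y : B} (hx : x ∈ O)
    (hy : y ∈ O) {E m j : ℤ} (hn : reducedNorm ℚ B x = 1 + 2 * E * m)
    (ht : reducedTrace ℚ B (x * standardInvolution ℚ B y) = 2 * j + 1) :
    ∃ x' ∈ O, (∃ z ∈ O, x' - x = (2 : ℤ) • z) ∧ (∃ m' : ℤ, reducedNorm ℚ B x' = 1 + 4 * E * m') ∧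
      ∃ j' : ℤ, reducedTrace ℚ B (x' * standardInvolution ℚ B y) = 2 * j' + 1 := by
  obtain ⟨-, n, -, hny⟩ := hO.exists_int_reducedTrace_reducedNorm hy
  have htyy : reducedTrace ℚ B (y * standardInvolution ℚ B y) = 2 * n := by
    rw [reducedTrace_mul_standardInvolution_self ℚ y, hny]
  refine ⟨x + (2 * E * m : ℤ) • y, O.add_mem hx (O.smul_mem _ hy),
    ⟨(E * m) • y, O.smul_mem _ hy, ?_⟩, ⟨m * (j + 1) + E * m ^ 2 * n, ?_⟩, ⟨j + 2 * E * m * n, ?_⟩⟩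
  · rw [add_sub_cancel_left, smul_smul]; ring_nf
  · rw [← Int.cast_smul_eq_zsmul ℚ, reducedNorm_add ℚ, hn, reducedNorm_smul ℚ, hny,
      standardInvolution_smul ℚ, mul_smul_comm, map_smul, smul_eq_mul, ht]
    push_cast; ring
  · rw [add_mul, map_add, ht, ← Int.cast_smul_eq_zsmul ℚ, smul_mul_assoc, map_smul, smul_eq_mul,
      htyy]
    push_cast; ring

/-- Three `2`-adic steps: from `nrd x₀` odd and a parity witness `y`, an `x₁ ∈ x₀ + 2O` with
`nrd x₁ ≡ 1 (mod 16)`. [cite: VignerasLNM800, Ch. II §1 Lemme 1.10] -/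
private theorem exists_congr_two_reducedNorm_sixteen {O : Submodule ℤ B} (hO : Brandt.IsOrder B O)
    {x₀ y : B} (hx₀ : x₀ ∈ O) (hy : y ∈ O) {k j : ℤ} (hn : reducedNorm ℚ B x₀ = 1 + 2 * k)
    (ht : reducedTrace ℚ B (x₀ * standardInvolution ℚ B y) = 2 * j + 1) :
    ∃ x₁ ∈ O, (∃ z ∈ O, x₁ - x₀ = (2 : ℤ) • z) ∧ ∃ k' : ℤ, reducedNorm ℚ B x₁ = 1 + 16 * k' := by
  obtain ⟨x₁, hx₁, ⟨z₁, hz₁, hxz₁⟩, ⟨m₁, hm₁⟩, ⟨j₁, hj₁⟩⟩ :=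
    twoAdicStep hO hx₀ hy (E := 1) (m := k) (j := j) (by rw [hn]; ring) ht
  obtain ⟨x₂, hx₂, ⟨z₂, hz₂, hxz₂⟩, ⟨m₂, hm₂⟩, ⟨j₂, hj₂⟩⟩ :=
    twoAdicStep hO hx₁ hy (E := 2) (m := m₁) (j := j₁) (by rw [hm₁]; ring) hj₁
  obtain ⟨x₃, hx₃, ⟨z₃, hz₃, hxz₃⟩, ⟨m₃, hm₃⟩, -⟩ :=
    twoAdicStep hO hx₂ hy (E := 4) (m := m₂) (j := j₂) (by rw [hm₂]; ring) hj₂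
  refine ⟨x₃, hx₃, ⟨z₁ + z₂ + z₃, O.add_mem (O.add_mem hz₁ hz₂) hz₃, ?_⟩, ⟨m₃, by rw [hm₃]; ring⟩⟩
  have h : x₃ - x₀ = (x₃ - x₂) + (x₂ - x₁) + (x₁ - x₀) := by abel
  rw [h, hxz₁, hxz₂, hxz₃, smul_add, smul_add]
  abel

/-! ### 3. Strong approximation in residue form at a prime -/

omit [Algebra ℚ B] [IsQuaternionAlgebra ℚ B] in
/-- The congruence lattice `Λ = ℤ x₁ + q O = {x ∈ O : x - c x₁ ∈ q O for some c ∈ ℤ}` as a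
`ℤ`-submodule. [folklore] -/
private theorem exists_congrLattice (O : Submodule ℤ B) (x₁ : B) (q : ℕ) :
    ∃ Λ : Submodule ℤ B, ∀ x, x ∈ Λ ↔ (x ∈ O ∧ ∃ c : ℤ, ∃ y ∈ O, x - c • x₁ = (q : ℤ) • y) := by
  refine ⟨{ carrier := {x | x ∈ O ∧ ∃ c : ℤ, ∃ y ∈ O, x - c • x₁ = (q : ℤ) • y}
            add_mem' := ?_, zero_mem' := ?_, smul_mem' := ?_ }, fun x => Iff.rfl⟩
  · rintro x x' ⟨hx, c, y, hyO, hc⟩ ⟨hx', c', y', hy'O, hc'⟩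
    refine ⟨O.add_mem hx hx', c + c', y + y', O.add_mem hyO hy'O, ?_⟩
    rw [smul_add, ← hc, ← hc', add_smul]; abel
  · exact ⟨O.zero_mem, 0, 0, O.zero_mem, by simp⟩
  · rintro m x ⟨hx, c, y, hyO, hc⟩
    refine ⟨O.smul_mem m hx, m * c, m • y, O.smul_mem m hyO, ?_⟩
    rw [← smul_smul, ← smul_sub, hc, smul_comm]

/-- **Strong approximation for `O¹`, residue form at a prime** (Eichler–Kneser; Vignéras III §4
Thm. 4.3 with `S = {∞}`, which satisfies the Eichler condition because `B ⊗ ℝ ≅ M₂(ℝ)`). Let `O` be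
an order of a quaternion algebra `B/ℚ` with a real representation `ι : B → M₂(ℝ)`, `q` a prime and
`x₀ ∈ O` with `nrd x₀ ≡ 1 (mod q)`; when `q = 2` assume moreover that `trd(x₀ ȳ)` is odd for some
`y ∈ O`. Then some `u ∈ O` of reduced norm `1` satisfies `u ≡ x₀ (mod q O)`.
[cite: VignerasLNM800, Ch. III §4 Thm. 4.3 and §5] [cite: Voight2021, Thm. 28.5.3 and Cor. 28.5.4] -/
theorem exists_reducedNorm_eq_one_sub_eq_smul_of_prime (ι : B →ₐ[ℚ] Matrix (Fin 2) (Fin 2) ℝ)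
    {O : Submodule ℤ B} (hO : Brandt.IsOrder B O) {q : ℕ} (hq : q.Prime) {x₀ : B} (hx₀ : x₀ ∈ O)
    (hn₀ : ∃ k : ℤ, reducedNorm ℚ B x₀ = 1 + q * k)
    (h₂ : q = 2 → ∃ y ∈ O, ∃ j : ℤ, reducedTrace ℚ B (x₀ * standardInvolution ℚ B y) = 2 * j + 1) :
    ∃ u ∈ O, reducedNorm ℚ B u = 1 ∧ ∃ y ∈ O, u - x₀ = (q : ℤ) • y := by
  classical
  have hq0 : q ≠ 0 := hq.ne_zero
  -- Step 0: the cofactor `M'` (`8` at `q = 2`, `1` otherwise) and an `x₁ ≡ x₀ (mod qO)` with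
  -- `nrd x₁ = 1 + q M' k₁`
  set M' : ℤ := if q = 2 then 8 else 1 with hM'
  obtain ⟨x₁, hx₁, ⟨z₀, hz₀, hxz₀⟩, k₁, hk₁⟩ : ∃ x₁ ∈ O, (∃ z ∈ O, x₁ - x₀ = (q : ℤ) • z) ∧
      ∃ k₁ : ℤ, reducedNorm ℚ B x₁ = 1 + q * M' * k₁ := by
    by_cases hq2 : q = 2
    · obtain ⟨y, hy, j, hj⟩ := h₂ hq2
      obtain ⟨k, hk⟩ := hn₀
      subst hq2
      obtain ⟨x₁, hx₁, hz, k', hk'⟩ :=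
        exists_congr_two_reducedNorm_sixteen hO hx₀ hy (k := k) (j := j) (by rw [hk]; push_cast; ring) hj
      have hM'v : M' = 8 := by rw [hM', if_pos rfl]
      refine ⟨x₁, hx₁, hz, k', ?_⟩
      rw [hk', hM'v]; push_cast; ring
    · obtain ⟨k, hk⟩ := hn₀
      have hM'v : M' = 1 := by rw [hM', if_neg hq2]
      refine ⟨x₀, hx₀, ⟨0, O.zero_mem, by simp⟩, k, ?_⟩
      rw [hk, hM'v]; push_cast; ring
  have hM'8 : (q : ℚ) * M' / 8 = if q = 2 then 2 else (q : ℚ) / 8 := by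
    split_ifs with hq2
    · subst hq2; rw [hM', if_pos rfl]; norm_num
    · rw [hM', if_neg hq2]; push_cast; ring
  -- Step 1: the lattice `Λ = ℤ x₁ + q O`
  obtain ⟨Λ, hΛ⟩ := exists_congrLattice O x₁ q
  have hΛle : Λ ≤ O := fun x hx => ((hΛ x).mp hx).1
  have hqmem : ∀ x ∈ O, ((q : ℕ) : ℤ) • x ∈ Λ := fun x hx =>
    (hΛ _).mpr ⟨O.smul_mem _ hx, 0, x, hx, by rw [zero_smul, sub_zero]⟩
  have hx₁Λ : x₁ ∈ Λ := (hΛ _).mpr ⟨hx₁, 1, 0, O.zero_mem, by simp⟩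
  have hΛfull : IsFullLattice B Λ :=
    isFullLattice_of_between hO.isFullLattice hΛle (m := ((q : ℕ) : ℤ)) (by exact_mod_cast hq0) hqmem
  -- Step 2: an integral model `H = ℍ[ℚ,a,b]` of `B`
  obtain ⟨a, b, ha, hb, ⟨e⟩⟩ :=
    QuaternionAlgebra.exists_algEquiv_quaternionAlgebra_integers (K := ℚ) (D := B)
  have hinjO := FaithfulSMul.algebraMap_injective (𝓞 ℚ) ℚ
  haveI : IsQuaternionAlgebra ℚ ℍ[ℚ,algebraMap (𝓞 ℚ) ℚ a,algebraMap (𝓞 ℚ) ℚ b] :=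
    QuaternionAlgebra.isQuaternionAlgebra_holds ((map_ne_zero_iff _ hinjO).mpr ha)
      ((map_ne_zero_iff _ hinjO).mpr hb)
  set ΛH : Submodule ℤ ℍ[ℚ,algebraMap (𝓞 ℚ) ℚ a,algebraMap (𝓞 ℚ) ℚ b] :=
    Λ.map (e.toRingEquiv.toAddEquiv.toIntLinearEquiv :
      B →ₗ[ℤ] ℍ[ℚ,algebraMap (𝓞 ℚ) ℚ a,algebraMap (𝓞 ℚ) ℚ b]) with hΛH
  have hΛHfull : IsFullLattice _ ΛH := hΛfull.map_ringEquiv e.toRingEquiv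
  have hdef : ¬ IsTotallyDefinite ℚ ℍ[ℚ,algebraMap (𝓞 ℚ) ℚ a,algebraMap (𝓞 ℚ) ℚ b] := by
    obtain ⟨v⟩ : Nonempty (NumberField.InfinitePlace ℚ) := inferInstance
    exact fun h => h v (isSplitAtInfinite_of_algHom_real
      (ι.comp (e.symm : ℍ[ℚ,algebraMap (𝓞 ℚ) ℚ a,algebraMap (𝓞 ℚ) ℚ b] →ₐ[ℚ] B)) v)
  have hmemH : ∀ z : B, e z ∈ ΛH ↔ z ∈ Λ := fun z => by
    rw [hΛH, mem_map_ringEquiv_iff]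
    change e.symm (e z) ∈ Λ ↔ z ∈ Λ
    rw [e.symm_apply_apply]
  -- Step 3: local points of norm `1 + 8d`, `|d|_p < 1`
  have hloc : ∀ p : ℕ, p.Prime → ∃ z ∈ localAt p ΛH, ∃ d : ℚ, padicNorm p d < 1 ∧
      z * star z = algebraMap ℚ _ (1 + 8 * d) := by
    intro p hp
    haveI : Fact p.Prime := ⟨hp⟩
    by_cases hpq : p = q
    · subst hpq
      refine ⟨e x₁, le_localAt p ΛH ((hmemH x₁).mpr hx₁Λ), (p : ℚ) * M' / 8 * k₁, ?_, ?_⟩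
      · have hkint : padicNorm p (k₁ : ℚ) ≤ 1 := padicNorm.of_int _
        rw [padicNorm.mul, hM'8]
        split_ifs with hp2
        · subst hp2
          rw [show (2 : ℚ) = ((2 : ℕ) : ℚ) by norm_num, padicNorm.padicNorm_p_of_prime]
          calc (↑(2 : ℕ) : ℚ)⁻¹ * padicNorm 2 (k₁ : ℚ) ≤ (↑(2 : ℕ) : ℚ)⁻¹ * 1 := by gcongr
            _ < 1 := by norm_num
        · have h8 : ¬ p ∣ 8 := fun h8 =>
            hp2 ((Nat.prime_dvd_prime_iff_eq hp Nat.prime_two).mp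
              (hp.dvd_of_dvd_pow (show p ∣ 2 ^ 3 from h8)))
          have h8' : padicNorm p (8 : ℚ) = 1 := by
            exact_mod_cast (padicNorm.nat_eq_one_iff (p := p) 8).mpr h8
          rw [padicNorm.div, h8', div_one, padicNorm.padicNorm_p_of_prime]
          calc (p : ℚ)⁻¹ * padicNorm p (k₁ : ℚ) ≤ (p : ℚ)⁻¹ * 1 := by gcongr
            _ < 1 := by rw [mul_one]; exact inv_lt_one_of_one_lt₀ (by exact_mod_cast hp.one_lt)
      · rw [QuaternionAlgebra.mul_star_self_eq_algebraMap_reducedNorm ℚ (e x₁),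
          reducedNorm_algEquiv e x₁, hk₁]
        congr 1
        ring
    · -- `z = 1 ∈ Λ₍ₚ₎` since `q · 1 ∈ Λ` with `p ≠ q`
      refine ⟨1, mem_localAt_iff.mpr ⟨q, hq0, ?_, ?_⟩, 0, by simp, by simp⟩
      · exact (Nat.coprime_primes hq hp).mpr (Ne.symm hpq)
      · have h1 := (hmemH _).mpr (hqmem 1 hO.one_mem)
        rwa [map_zsmul, map_one] at h1
  -- Step 4: a norm-one point `u₀ = c x₁ + q y` of `Λ`
  obtain ⟨xH, hxΛ, hx1⟩ := QuaternionAlgebra.exists_mem_mul_star_eq_one a b ha hb hdef hΛHfull hloc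
  set u₀ : B := e.symm xH with hu₀
  have hu₀Λ : u₀ ∈ Λ := (mem_map_ringEquiv_iff e.toRingEquiv).mp hxΛ
  have hnu₀ : reducedNorm ℚ B u₀ = 1 := by
    have h := (QuaternionAlgebra.mul_star_self_eq_one_iff ℚ xH).mp hx1
    rwa [← e.apply_symm_apply xH, reducedNorm_algEquiv e] at h
  obtain ⟨hu₀O, c, y, hy, hcy⟩ := (hΛ u₀).mp hu₀Λ
  -- Step 5: `c² ≡ 1 (mod q)`
  obtain ⟨t, -, ht, -⟩ :=
    hO.exists_int_reducedTrace_reducedNorm (hO.mul_mem _ hx₁ _ (hO.standardInvolution_mem hy))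
  obtain ⟨-, n, -, hny⟩ := hO.exists_int_reducedTrace_reducedNorm hy
  have hu₀eq : u₀ = (c : ℚ) • x₁ + ((q : ℤ) : ℚ) • y := by
    rw [Int.cast_smul_eq_zsmul, Int.cast_smul_eq_zsmul, ← hcy]; abel
  have hnorm : reducedNorm ℚ B u₀ = (c : ℚ) ^ 2 * (1 + q * M' * k₁) + ((q : ℤ) : ℚ) ^ 2 * n +
      (c : ℚ) * ((q : ℤ) : ℚ) * t := by
    rw [hu₀eq, reducedNorm_add ℚ, reducedNorm_smul ℚ, reducedNorm_smul ℚ, hk₁, hny,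
      standardInvolution_smul ℚ, smul_mul_smul_comm, map_smul, smul_eq_mul, ht]
  have hnormZ : (1 : ℤ) = c ^ 2 * (1 + q * M' * k₁) + (q : ℤ) ^ 2 * n + c * q * t := by
    exact_mod_cast hnu₀.symm.trans hnorm
  have hdvd : (q : ℤ) ∣ (c - 1) * (c + 1) :=
    ⟨-(c ^ 2 * M' * k₁ + q * n + c * t), by linear_combination -hnormZ⟩
  have hqZ : Prime (q : ℤ) := Nat.prime_iff_prime_int.mp hq
  -- Step 6: `u = ± u₀`
  rcases hqZ.dvd_or_dvd hdvd with ⟨r, hr⟩ | ⟨r, hr⟩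
  · -- `c = 1 + q r`
    refine ⟨u₀, hu₀O, hnu₀, y + r • x₁ + z₀, O.add_mem (O.add_mem hy (O.smul_mem _ hx₁)) hz₀, ?_⟩
    have hc : c = 1 + q * r := by linear_combination hr
    have h : u₀ - x₀ = (u₀ - c • x₁) + (c - 1) • x₁ + (x₁ - x₀) := by rw [sub_smul, one_smul]; abel
    rw [h, hcy, hxz₀, hc, add_sub_cancel_left, smul_add, smul_add, ← smul_smul]
  · -- `c = -1 + q r`
    refine ⟨-u₀, O.neg_mem hu₀O, by rw [reducedNorm_neg ℚ, hnu₀], -y - r • x₁ + z₀,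
      O.add_mem (O.sub_mem (O.neg_mem hy) (O.smul_mem _ hx₁)) hz₀, ?_⟩
    have hc : c = -1 + q * r := by linear_combination hr
    have h : -u₀ - x₀ = -(u₀ - c • x₁) - (c + 1) • x₁ + (x₁ - x₀) := by
      rw [add_smul, one_smul]; abel
    rw [h, hcy, hxz₀, hc, neg_add_cancel_comm, smul_add, smul_sub, smul_neg, ← smul_smul]

/-! ### 4. Through a residue map `O ↠ M₂(𝔽_q)`: `O¹ ↠ SL₂(𝔽_q)` -/

/-- A parity witness in `M₂(𝔽₂)`: for `det g = 1` some `Y` has `det(g + Y) - det g - det Y = 1`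
(the polar form `g₀₀Y₁₁ + g₁₁Y₀₀ - g₀₁Y₁₀ - g₁₀Y₀₁` of `det` does not vanish identically on
`SL₂(𝔽₂)`-elements). [folklore] -/
private theorem exists_det_add_sub_eq_one (g : Matrix (Fin 2) (Fin 2) (ZMod 2)) (hg : g.det = 1) :
    ∃ Y : Matrix (Fin 2) (Fin 2) (ZMod 2), (g + Y).det - g.det - Y.det = 1 := by
  have key : ∀ Y : Matrix (Fin 2) (Fin 2) (ZMod 2), (g + Y).det - g.det - Y.det =
      g 0 0 * Y 1 1 + Y 0 0 * g 1 1 - g 0 1 * Y 1 0 - Y 0 1 * g 1 0 := by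
    intro Y
    simp only [Matrix.det_fin_two, Matrix.add_apply]
    ring
  have h01 : ∀ a : ZMod 2, a = 0 ∨ a = 1 := by decide
  rcases h01 (g 0 0) with h0 | h0
  · -- `det g = -g₀₁g₁₀ = 1` forces `g₀₁ = 1`; take `Y = E₁₀`
    have hmul : ∀ a b : ZMod 2, -(a * b) = 1 → a = 1 := by decide
    have hg01 : g 0 1 = 1 := by
      rw [Matrix.det_fin_two, h0] at hg
      exact hmul (g 0 1) (g 1 0) (by linear_combination hg)
    refine ⟨!![0, 0; 1, 0], ?_⟩
    have e00 : (!![0, 0; 1, 0] : Matrix (Fin 2) (Fin 2) (ZMod 2)) 0 0 = 0 := rfl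
    have e01 : (!![0, 0; 1, 0] : Matrix (Fin 2) (Fin 2) (ZMod 2)) 0 1 = 0 := rfl
    have e10 : (!![0, 0; 1, 0] : Matrix (Fin 2) (Fin 2) (ZMod 2)) 1 0 = 1 := rfl
    have e11 : (!![0, 0; 1, 0] : Matrix (Fin 2) (Fin 2) (ZMod 2)) 1 1 = 0 := rfl
    rw [key, e00, e01, e10, e11, h0, hg01]
    simp only [zero_mul, mul_one, zero_add, sub_zero, zero_sub]
    decide
  · -- take `Y = E₁₁`
    refine ⟨!![0, 0; 0, 1], ?_⟩
    have e00 : (!![0, 0; 0, 1] : Matrix (Fin 2) (Fin 2) (ZMod 2)) 0 0 = 0 := rfl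
    have e01 : (!![0, 0; 0, 1] : Matrix (Fin 2) (Fin 2) (ZMod 2)) 0 1 = 0 := rfl
    have e10 : (!![0, 0; 0, 1] : Matrix (Fin 2) (Fin 2) (ZMod 2)) 1 0 = 0 := rfl
    have e11 : (!![0, 0; 0, 1] : Matrix (Fin 2) (Fin 2) (ZMod 2)) 1 1 = 1 := rfl
    rw [key, e00, e01, e10, e11, h0]
    ring

/-- **`O¹ ↠ SL₂(𝔽_q)` through a reduction datum** (Vignéras III §4 Thm. 4.3 and §5; Shimura
Lemma 1.38 for `M₂(ℤ)`). Let `O` be an order of a quaternion algebra `B/ℚ` with a real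
representation `ι`, `S` the same order as a subring, `q` a prime and `red : S → M₂(𝔽_q)` a ring
map which is onto, has kernel `q O` and satisfies `det (red x) = nrd x (mod q)`. Then every
`g ∈ M₂(𝔽_q)` of determinant `1` is `red u` for some `u ∈ O` with `nrd u = 1`.
[cite: VignerasLNM800, Ch. III §4 Thm. 4.3 and §5] [cite: ShimuraIATAF1971, Lemma 1.38] -/
theorem exists_reducedNorm_eq_one_map_eq_of_det_eq_one (ι : B →ₐ[ℚ] Matrix (Fin 2) (Fin 2) ℝ)
    {O : Submodule ℤ B} (hO : Brandt.IsOrder B O) (S : Subring B) (hS : ∀ x : B, x ∈ S ↔ x ∈ O)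
    {q : ℕ} [Fact q.Prime] (red : S →+* Matrix (Fin 2) (Fin 2) (ZMod q))
    (hsurj : Function.Surjective red)
    (hker : ∀ x : S, red x = 0 ↔ ∃ y ∈ O, (x : B) = (q : ℤ) • y)
    (hdet : ∀ x : S, ∃ n : ℤ, reducedNorm ℚ B (x : B) = n ∧ (red x).det = (n : ZMod q))
    (g : Matrix (Fin 2) (Fin 2) (ZMod q)) (hg : g.det = 1) :
    ∃ u : S, reducedNorm ℚ B (u : B) = 1 ∧ red u = g := by
  have hq : q.Prime := Fact.out
  obtain ⟨x₀, hx₀⟩ := hsurj g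
  have hx₀O : (x₀ : B) ∈ O := (hS _).mp x₀.2
  -- `nrd x₀ ≡ 1 (mod q)`
  obtain ⟨n, hn, hdn⟩ := hdet x₀
  rw [hx₀] at hdn
  have h1n : (1 : ZMod q) = n := hg.symm.trans hdn
  have hn₀ : ∃ k : ℤ, reducedNorm ℚ B (x₀ : B) = 1 + q * k := by
    have h : ((n - 1 : ℤ) : ZMod q) = 0 := by push_cast; rw [← h1n, sub_self]
    obtain ⟨k, hk⟩ := (ZMod.intCast_zmod_eq_zero_iff_dvd _ _).mp h
    exact ⟨k, by rw [hn]; exact_mod_cast (by linear_combination hk : (n : ℤ) = 1 + q * k)⟩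
  -- the parity witness at `q = 2`, read off `red`
  have h₂ : q = 2 → ∃ y ∈ O, ∃ j : ℤ,
      reducedTrace ℚ B ((x₀ : B) * standardInvolution ℚ B y) = 2 * j + 1 := by
    intro hq2
    subst hq2
    obtain ⟨Y, hY⟩ := exists_det_add_sub_eq_one g hg
    obtain ⟨y₀, hy₀⟩ := hsurj Y
    obtain ⟨nxy, hnxy, hdnxy⟩ := hdet (x₀ + y₀)
    obtain ⟨ny, hny, hdny⟩ := hdet y₀
    rw [map_add, hx₀, hy₀] at hdnxy
    rw [hy₀] at hdny
    have hT : reducedTrace ℚ B ((x₀ : B) * standardInvolution ℚ B (y₀ : B)) =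
        (nxy - n - ny : ℤ) := by
      have h := reducedNorm_add ℚ (x₀ : B) (y₀ : B)
      rw [← Subring.coe_add, hnxy, hn, hny] at h
      push_cast
      linear_combination -h
    have hodd : ((nxy - n - ny : ℤ) : ZMod 2) = 1 := by
      push_cast
      rw [← hdnxy, ← hdn, ← hdny]
      exact hY
    have hodd' : (((nxy - n - ny : ℤ) - 1 : ℤ) : ZMod 2) = 0 := by
      rw [Int.cast_sub, hodd, Int.cast_one, sub_self]
    obtain ⟨j, hj⟩ := (ZMod.intCast_zmod_eq_zero_iff_dvd _ _).mp hodd'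
    refine ⟨y₀, (hS _).mp y₀.2, j, ?_⟩
    rw [hT]
    exact_mod_cast (by linear_combination hj : (nxy - n - ny : ℤ) = 2 * j + 1)
  -- strong approximation
  obtain ⟨u, huO, hnu, y, hy, huy⟩ :=
    exists_reducedNorm_eq_one_sub_eq_smul_of_prime ι hO hq hx₀O hn₀ h₂
  refine ⟨⟨u, (hS u).mpr huO⟩, hnu, ?_⟩
  have hdiff : red (⟨u, (hS u).mpr huO⟩ - x₀) = 0 := (hker _).mpr ⟨y, hy, by simpa using huy⟩
  rwa [map_sub, sub_eq_zero, hx₀] at hdiff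

end Literature.NumberTheory.Automorphic

end
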